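import Summits.QuantumFields.BalabanUV.Beta.FP.PackedVertexPeriodisation
import Summits.QuantumFields.BalabanUV.Beta.CombHId2TorusRecord

/-!
# `BalabanUV.Beta.FP.PackedRecordSlotsOne` — road «FP» for binder row D1, ROUTE T, memo `N2B-DESIGN.md` (34h) STEP 3, letter (S3-2)-(ii) AT THE RECORD, ORDER 1:
# **THE RECORD's TWO FIRST-ORDER VERTICES — the field vertex `vertexOfK G Lc S^per_j` (the `Θ`-columns, where `H₁ ∕ Q₁₁` bind) and the multiplier vertex
# `vertexOfM G Lc M^per_j` (the `Ŝ`-columns) — ARE `perF M` OF `dper M` OF ONE PACKED BI-LOCALISED KERNEL EACH, the averaging kernel's `Â`-columns as weights**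

WHY.  an2's PART THREE crown 2c-iii `CombHId2TorusRecord` (p358222 ✓) reads the record's first-order vertices entrywise as bond sums
`perF_vertexOfK_comb_apply` (`Σ_{u,κ} Â((u, inl κ),(wrapPt M (Lc•y), inr μ)) · perF M (dper M (S^pure_j κ u)) P Q`) and `perF_vertexOfM_comb_apply`
(`Σ_{w,ρ} Â((wrapPt M (Lc•w), inr ρ),(wrapPt M (Lc•y), inr μ)) · perF M (dper M (M_j ρ w)) P Q`), one hypothesis `hM : M = Lc·M′`.  The level-0 socket (#36b) and
its adapters (#37 ∕ #37c) carry the door's FIRST form jet as a PACKED table family `H₁ v = a • Σ_b (hv v b) • TW b + …`; STEP 3 must recognise every packed jet as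
`perF M (dper M 𝒱)` of ONE kernel so that (P2‴) `KernelPeriodisationFibHessKer.hessKer_law_of_torus_hessT_law`'s `hlaw` can be stated.  #38
`PackedVertexPeriodisation` §1 (`sum_smul_perF_dper`) is the abstract packing letter, #38b `PackedRecordSlots` applied it to the two ORDER-2 slots; THIS FILE is the
ORDER-1 twin: the weights ARE the `Â := perF M (GcombSh Lc j)` columns of the top bond `(μ, y)` (fine `Θ`-columns for the field vertex, coarse `Ŝ`-columns for the
multiplier vertex), the bi-localisation witnesses are the record's own letters `CombChartStepJets.locStencil_SpureCombOf` (a `LocStencil` IS a per-bond `BiLoc`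
at `(u, u)`) and `tabs.hM j` (a `VertexFamily` IS a per-bond `BiLoc` at `(Lc•w, Lc•w)`); §3 adds the two up: the full first-order response
`D̂_{μy} = perF M (dM G Lc S^per M^per μ y)` (2c-iii `perF_dM_comb`) is `perF∘dper` of ONE kernel packed over the disjoint union of the fine and the coarse bonds.
[folklore] composition BY NAME; no `def`, no `def … : Prop`, nothing cited, 0 sorry.  NOT HERE: the identification of the socket's direction read-out `hv (d k)`
with the `Â`-column (the nested layer's `V := σ → ℝ` instance), the graded block read-out along the packing injection (leaf-06 `PackedLegFullIndex` §3), the legs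
(S3-1), the assembly (S3-3).

HONEST DEPENDENCY (page 1, mandatory): continuum YM on T⁴ ⇐ BetaPertH ∧ nine spine estimates (0/9 proved); BetaPertH ⇐ (D1) ∧ (D4) ∧ CAP+tail;
G-an2-4 gates asym, D1 and NE2/3/4.  HONEST FRAMING (cell contract, verbatim): «discharging `BetaPertH` makes Bałaban's UV stability UNCONDITIONAL —
a real constructive-QFT result; it is NOT the continuum limit and NOT the Clay problem.»  ABSOLUTE RULE (cell charter, verbatim): «No internally-minted
statement may enter as a cited fact. Every hypothesis is either kernel-proved in this package or a verbatim quotation of a PUBLISHED theorem with page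
reference. The manuscript(s) under audit are NOT citable for their own disputed steps — they are the thing under adjudication; programme-internal
(2001/route/tribunal) claims are never citable.»  Finite sums of absolutely convergent period sums over OUR typed objects; nothing of the dictionary's
identification ∕ Bałaban's asserted; 0 estimates beyond the record's decay letters; 0∕4 row-D1 binders (hW, hR, D1Tel, D1Rep); NOT (T-ID), NOT SDF, NOT
D1, NOT BetaPertH, NOT continuum, NOT Clay.  Road «FP» OWNER, b2b-balaban-beta-d1-p3 gen 26, 2026-08-23.  No existing file touched.
-/

noncomputable section

open scoped BigOperators Matrix

namespace Summit.QuantumFields.BalabanUV.Beta.FP.PackedRecordSlotsOne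

open Literature.MathematicalPhysics.QuantumFieldTheory.Balaban1983to89
open Literature.MathematicalPhysics.QuantumFieldTheory.Balaban1983to89.Beta
open ExpKernelCalculus (MKer)
open AffineAveraging (Site)
open OneStepResolventKernel (Fib)
open SecondOrderResponse (vertexOfM dM)
open OneStepKernelFamily (vertexOfK)
open Summit.QuantumFields.BalabanUV.Beta.FP.KernelPeriodisationFib (Idx perF)
open Summit.QuantumFields.BalabanUV.Beta.FP.KernelPeriodisationFibLoc (dper)
open Summit.QuantumFields.BalabanUV.Beta.FP.TorusGaugeCovariancePairing (wrapPt)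
open Summit.QuantumFields.BalabanUV.Beta.SymmetrisedStepJets (SymTables)
open Summit.QuantumFields.BalabanUV.Beta.CombChartStepJets (GcombSh SpureCombOf locStencil_SpureCombOf)
open B6Lemma24Torus (pbox)
open Summit.QuantumFields.BalabanUV.Beta.CombHId2TorusRecord (perF_vertexOfK_comb_apply perF_vertexOfM_comb_apply perF_dM_comb)
open Summit.QuantumFields.BalabanUV.Beta.FP.PackedVertexPeriodisation (sum_smul_perF_dper)

variable {d : ℕ} (M : Fin (d + 1) → ℕ) [∀ μ, NeZero (M μ)]
variable {Lc : ℕ} [NeZero Lc] {M' : Fin (d + 1) → ℕ} (tabs : SymTables d Lc) (cE cVH cΛ : ℝ)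

/-! ## §1 The FIELD vertex: the `Θ`-column packing of the pure first-order tables -/

/-- [folklore] **`perF_vertexOfK_comb_packed` — THE RECORD's FIELD VERTEX IS `perF∘dper` OF ONE PACKED KERNEL**: with `G := GcombSh Lc j`, `Â := perF M G`,
`S^pure_j κ u := SpureCombOf tabs cE cVH cΛ j κ u` and `M = Lc·M′`,
`perF M (vertexOfK G Lc (dper M ∘ S^pure_j) μ y) = perF M (dper M (Σ_{b ∈ pbox M × Fin (d+1)} Â((b.1, inl b.2),(wrapPt M (Lc•y), inr μ)) • S^pure_j b.2 b.1))` — the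
socket's `hH₁`-type shape `Σ_b (hv v b) • T b` at `hv (d (μ,y)) := Â(·,(μ,y))`'s `Θ`-column (2c-iii `perF_vertexOfK_comb_apply` + #38 §1 `sum_smul_perF_dper`; BiLoc by
`locStencil_SpureCombOf`). -/
theorem perF_vertexOfK_comb_packed (hM : ∀ i, M i = Lc * M' i) (j : ℕ) (μ : Fin (d + 1)) (y : Site (d + 1)) :
    perF M (vertexOfK (GcombSh (d := d) Lc j) Lc (fun κ u => dper M (SpureCombOf tabs cE cVH cΛ j κ u)) μ y)
      = perF M (dper M (∑ b : ↥(pbox M) × Fin (d + 1),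
          perF M (GcombSh (d := d) Lc j) (b.1, Sum.inl b.2) (wrapPt M ((Lc : ℤ) • y), Sum.inr μ) • SpureCombOf tabs cE cVH cΛ j b.2 (b.1 : Site (d + 1)))) := by
  obtain ⟨CS, δS, hδS, hS⟩ := locStencil_SpureCombOf tabs cE cVH cΛ j
  have h := sum_smul_perF_dper M (Finset.univ : Finset (↥(pbox M) × Fin (d + 1)))
      (fun b : ↥(pbox M) × Fin (d + 1) => perF M (GcombSh (d := d) Lc j) (b.1, Sum.inl b.2) (wrapPt M ((Lc : ℤ) • y), Sum.inr μ))
      (fun b : ↥(pbox M) × Fin (d + 1) => SpureCombOf tabs cE cVH cΛ j b.2 (b.1 : Site (d + 1)))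
      (fun b _ => ⟨_, _, _, _, (hS b.2 (b.1 : Site (d + 1))).nonneg (Sum.inl 0), hδS, hS b.2 (b.1 : Site (d + 1))⟩)
  rw [← h]
  ext P Q
  rw [perF_vertexOfK_comb_apply M tabs cE cVH cΛ hM j μ y P Q]
  simp only [Matrix.sum_apply, Matrix.smul_apply, smul_eq_mul, Fintype.sum_prod_type]

/-! ## §2 The MULTIPLIER vertex: the `Ŝ`-column packing of the multiplier tables (coarse bond index) -/

/-- [folklore] **`perF_vertexOfM_comb_packed`** — with `M^per_j ρ w := dper M (tabs.M j ρ w)`: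
`perF M (vertexOfM G Lc M^per_j μ y) = perF M (dper M (Σ_{b ∈ pbox M′ × Fin (d+1)} Â((wrapPt M (Lc•b.1), inr b.2),(wrapPt M (Lc•y), inr μ)) • tabs.M j b.2 b.1))` — ONE packed
kernel over the COARSE bond index (2c-iii `perF_vertexOfM_comb_apply` + #38 §1; BiLoc by `tabs.hM j`, a `VertexFamily` at the coarse bond positions). -/
theorem perF_vertexOfM_comb_packed [∀ μ, NeZero (M' μ)] (hM : ∀ i, M i = Lc * M' i) (j : ℕ) (μ : Fin (d + 1)) (y : Site (d + 1)) :
    perF M (vertexOfM (GcombSh (d := d) Lc j) Lc (fun ρ w => dper M (tabs.M j ρ w)) μ y)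
      = perF M (dper M (∑ b : ↥(pbox M') × Fin (d + 1),
          perF M (GcombSh (d := d) Lc j) (wrapPt M ((Lc : ℤ) • (b.1 : Site (d + 1))), Sum.inr b.2) (wrapPt M ((Lc : ℤ) • y), Sum.inr μ)
            • tabs.M j b.2 (b.1 : Site (d + 1)))) := by
  obtain ⟨CM, δM, hδM, hMloc⟩ := tabs.hM j
  have h := sum_smul_perF_dper M (Finset.univ : Finset (↥(pbox M') × Fin (d + 1)))
      (fun b : ↥(pbox M') × Fin (d + 1) =>
        perF M (GcombSh (d := d) Lc j) (wrapPt M ((Lc : ℤ) • (b.1 : Site (d + 1))), Sum.inr b.2) (wrapPt M ((Lc : ℤ) • y), Sum.inr μ))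
      (fun b : ↥(pbox M') × Fin (d + 1) => tabs.M j b.2 (b.1 : Site (d + 1)))
      (fun b _ => ⟨_, _, _, _, (hMloc b.2 (b.1 : Site (d + 1))).nonneg (Sum.inl 0), hδM, hMloc b.2 (b.1 : Site (d + 1))⟩)
  rw [← h]
  ext P Q
  rw [perF_vertexOfM_comb_apply M tabs hM j μ y P Q]
  simp only [Matrix.sum_apply, Matrix.smul_apply, smul_eq_mul, Fintype.sum_prod_type]

/-! ## §3 The full first-order response `D̂_{μy}`: ONE kernel packed over the disjoint union of the fine and the coarse bonds -/

/-- [folklore] **`perF_dM_comb_packed` — THE RECORD's FULL FIRST-ORDER RESPONSE IS `perF∘dper` OF ONE PACKED KERNEL**: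
`D̂_{μy} = perF M (dM G Lc S^per_j M^per_j μ y) = perF M (dper M (Σ_{b : fine} Â_b(μ,y) • S^pure_j b.2 b.1 + Σ_{b′ : coarse} Â_{b′}(μ,y) • tabs.M j b′.2 b′.1))`
(2c-iii `perF_dM_comb` = field vertex + multiplier vertex; §1 + §2; #38 §1 once more over the index `(pbox M × Fin) ⊕ (pbox M′ × Fin)` to merge the two
periodisations — `Fintype.sum_sum_type`). -/
theorem perF_dM_comb_packed [∀ μ, NeZero (M' μ)] (hM : ∀ i, M i = Lc * M' i) (j : ℕ) (μ : Fin (d + 1)) (y : Site (d + 1)) :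
    perF M (dM (GcombSh (d := d) Lc j) Lc (fun κ u => dper M (SpureCombOf tabs cE cVH cΛ j κ u)) (fun ρ w => dper M (tabs.M j ρ w)) μ y)
      = perF M (dper M
          (∑ b : ↥(pbox M) × Fin (d + 1),
              perF M (GcombSh (d := d) Lc j) (b.1, Sum.inl b.2) (wrapPt M ((Lc : ℤ) • y), Sum.inr μ) • SpureCombOf tabs cE cVH cΛ j b.2 (b.1 : Site (d + 1))
            + ∑ b : ↥(pbox M') × Fin (d + 1),
              perF M (GcombSh (d := d) Lc j) (wrapPt M ((Lc : ℤ) • (b.1 : Site (d + 1))), Sum.inr b.2) (wrapPt M ((Lc : ℤ) • y), Sum.inr μ)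
                • tabs.M j b.2 (b.1 : Site (d + 1)))) := by
  obtain ⟨CS, δS, hδS, hS⟩ := locStencil_SpureCombOf tabs cE cVH cΛ j
  obtain ⟨CM, δM, hδM, hMloc⟩ := tabs.hM j
  -- ONE application of #38 §1 over the disjoint union of the two bond index types
  have h := sum_smul_perF_dper M (Finset.univ : Finset ((↥(pbox M) × Fin (d + 1)) ⊕ (↥(pbox M') × Fin (d + 1))))
      (Sum.elim
        (fun b : ↥(pbox M) × Fin (d + 1) => perF M (GcombSh (d := d) Lc j) (b.1, Sum.inl b.2) (wrapPt M ((Lc : ℤ) • y), Sum.inr μ))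
        (fun b : ↥(pbox M') × Fin (d + 1) =>
          perF M (GcombSh (d := d) Lc j) (wrapPt M ((Lc : ℤ) • (b.1 : Site (d + 1))), Sum.inr b.2) (wrapPt M ((Lc : ℤ) • y), Sum.inr μ)))
      (Sum.elim (fun b : ↥(pbox M) × Fin (d + 1) => SpureCombOf tabs cE cVH cΛ j b.2 (b.1 : Site (d + 1)))
        (fun b : ↥(pbox M') × Fin (d + 1) => tabs.M j b.2 (b.1 : Site (d + 1))))
      (fun i _ => by
        cases i with
        | inl b => exact ⟨_, _, _, _, (hS b.2 (b.1 : Site (d + 1))).nonneg (Sum.inl 0), hδS, hS b.2 (b.1 : Site (d + 1))⟩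
        | inr b => exact ⟨_, _, _, _, (hMloc b.2 (b.1 : Site (d + 1))).nonneg (Sum.inl 0), hδM, hMloc b.2 (b.1 : Site (d + 1))⟩)
  simp only [Fintype.sum_sum_type, Sum.elim_inl, Sum.elim_inr] at h
  -- the two packed periodisations of §1 ∕ §2, unpacked again by #38 §1, are the two bond sums
  have h1 := sum_smul_perF_dper M (Finset.univ : Finset (↥(pbox M) × Fin (d + 1)))
      (fun b : ↥(pbox M) × Fin (d + 1) => perF M (GcombSh (d := d) Lc j) (b.1, Sum.inl b.2) (wrapPt M ((Lc : ℤ) • y), Sum.inr μ))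
      (fun b : ↥(pbox M) × Fin (d + 1) => SpureCombOf tabs cE cVH cΛ j b.2 (b.1 : Site (d + 1)))
      (fun b _ => ⟨_, _, _, _, (hS b.2 (b.1 : Site (d + 1))).nonneg (Sum.inl 0), hδS, hS b.2 (b.1 : Site (d + 1))⟩)
  have h2 := sum_smul_perF_dper M (Finset.univ : Finset (↥(pbox M') × Fin (d + 1)))
      (fun b : ↥(pbox M') × Fin (d + 1) =>
        perF M (GcombSh (d := d) Lc j) (wrapPt M ((Lc : ℤ) • (b.1 : Site (d + 1))), Sum.inr b.2) (wrapPt M ((Lc : ℤ) • y), Sum.inr μ))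
      (fun b : ↥(pbox M') × Fin (d + 1) => tabs.M j b.2 (b.1 : Site (d + 1)))
      (fun b _ => ⟨_, _, _, _, (hMloc b.2 (b.1 : Site (d + 1))).nonneg (Sum.inl 0), hδM, hMloc b.2 (b.1 : Site (d + 1))⟩)
  rw [← h, perF_dM_comb M tabs cE cVH cΛ hM j μ y, perF_vertexOfK_comb_packed M tabs cE cVH cΛ hM j μ y,
    perF_vertexOfM_comb_packed M tabs hM j μ y, ← h1, ← h2]

end Summit.QuantumFields.BalabanUV.Beta.FP.PackedRecordSlotsOne

end
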